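import Summits.AtomisticToContinuum.HydrodynamicLimit.Theorems.TwoClocksTransferActivityTailsDriftTransferTools
import HarnessLib

/-!
# `TransferActivityTails` (stmt-AtomisticToContinuum-16624), line `Sketch` (card `predictor-drift-doob`):
# the estimate at a fixed particle number (file 2 of 3)

Helper file (`--supports stmt-AtomisticToContinuum-16624`) for the crux
`Summit.AtomisticToContinuum.HydrodynamicLimit.Theses.TwoClocks.TransferActivityTails`, skeleton
`Cruxes/TransferActivityTails/Lines/Sketch_a1.lean` (lead a1), registered stub `stub_driftTransfer`.  On an abstract
probability space with `n + 1` spheres and block activities `X i j` (nonnegative, a.e.-measurable, `K + 1` blocks):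
the two Markov inputs
`Σ_i P(K+1 ≤ Σ_{j<L} X_{ij}) ≤ (n+1)L(M+δ)/(K+1)` and `Σ_i P(K+1 ≤ Σ_j (X_{ij} − M)₊) ≤ (n+1)δ`, and the assembly
`∫⁻ ofReal ((n+1)⁻¹ Σ_i a_i𝟙{V < a_i}) ≤ ofReal (2B + 2M'(L(M+δ)/(K+1) + δ + M²/(4(K+1))))` for activities
`a_i ≤ 2ā_i` a.e., given the per-sphere exceedance bound of the drift engine (registered sub-goal
`stub_driftTransferFixedN`).  Elementary; the hinge part is imported from `…DriftTransferTools`.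
-/

noncomputable section

open MeasureTheory Filter Set Topology
open scoped ENNReal BigOperators

namespace Summit.AtomisticToContinuum.HydrodynamicLimit.Theorems.TransferActivityTailsDriftTransferFixedN

open Summit.AtomisticToContinuum.HydrodynamicLimit.Theorems.CollisionActivityTailsEndpointTails (tailFn)
open Summit.AtomisticToContinuum.HydrodynamicLimit.Theorems.TransferActivityTailsDriftTransferTools

/-! ## The estimate at a fixed particle number (abstract probability space)

Throughout: a probability space `(Ω, P)`, `n + 1` spheres, block activities `X i j : Ω → ℝ` (nonnegative,
a.e.-measurable), `K + 1` blocks. -/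

section FixedN

variable {Ω : Type} [MeasurableSpace Ω] {P : Measure Ω} [IsProbabilityMeasure P] {n : ℕ}
  {X : Fin (n + 1) → ℕ → Ω → ℝ}

/-- **First blocks, by Markov.**  `Σ_i P(K+1 ≤ Σ_{j<L} X_{ij}) ≤ (n+1)·L(M+δ)/(K+1)`. -/
theorem sum_meas_firstBlocks_le (hXm : ∀ i j, AEMeasurable (X i j) P) (hX0 : ∀ i j ω, 0 ≤ X i j ω) (K L : ℕ)
    (hLK : L ≤ K + 1) {M δ : ℝ} (hM : 0 ≤ M) (hδ : 0 ≤ δ)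
    (hUI : ∀ j, j < K + 1 →
      ∫⁻ ω, ENNReal.ofReal (((n : ℝ) + 1)⁻¹ * ∑ i : Fin (n + 1), max (X i j ω - M) 0) ∂P ≤ ENNReal.ofReal δ) :
    ∑ i : Fin (n + 1), P {ω | ((K : ℝ) + 1) ≤ ∑ j ∈ Finset.range L, X i j ω} ≤
      ENNReal.ofReal (((n : ℝ) + 1) * (L * (M + δ) / ((K : ℝ) + 1))) := by
  have hKpos : (0 : ℝ) < (K : ℝ) + 1 := by positivity
  have hmean : ∀ j, j < K + 1 → ∑ i : Fin (n + 1), ∫⁻ ω, ENNReal.ofReal (X i j ω) ∂P ≤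
      ENNReal.ofReal (((n : ℝ) + 1) * (M + δ)) :=
    fun j hj => sum_lintegral_le_of_overshoot hXm hX0 hM hδ j (hUI j hj)
  have hmarkov : ∀ i, P {ω | ((K : ℝ) + 1) ≤ ∑ j ∈ Finset.range L, X i j ω} ≤
      (ENNReal.ofReal ((K : ℝ) + 1))⁻¹ * ∫⁻ ω, ENNReal.ofReal (∑ j ∈ Finset.range L, X i j ω) ∂P :=
    fun i => meas_ge_le_inv_mul_lintegral (Finset.aemeasurable_fun_sum _ fun j _ => hXm i j) hKpos
  calc ∑ i : Fin (n + 1), P {ω | ((K : ℝ) + 1) ≤ ∑ j ∈ Finset.range L, X i j ω}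
      ≤ ∑ i : Fin (n + 1), (ENNReal.ofReal ((K : ℝ) + 1))⁻¹ *
          ∫⁻ ω, ENNReal.ofReal (∑ j ∈ Finset.range L, X i j ω) ∂P := Finset.sum_le_sum fun i _ => hmarkov i
    _ = (ENNReal.ofReal ((K : ℝ) + 1))⁻¹ *
          ∑ i : Fin (n + 1), ∑ j ∈ Finset.range L, ∫⁻ ω, ENNReal.ofReal (X i j ω) ∂P := by
        rw [← Finset.mul_sum]
        congr 1
        refine Finset.sum_congr rfl fun i _ => ?_
        exact lintegral_ofReal_sum (Finset.range L) (fun j ω => X i j ω) (fun j _ => hXm i j)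
          (fun j _ ω => hX0 i j ω)
    _ = (ENNReal.ofReal ((K : ℝ) + 1))⁻¹ *
          ∑ j ∈ Finset.range L, ∑ i : Fin (n + 1), ∫⁻ ω, ENNReal.ofReal (X i j ω) ∂P := by
        rw [Finset.sum_comm]
    _ ≤ (ENNReal.ofReal ((K : ℝ) + 1))⁻¹ * ∑ _j ∈ Finset.range L, ENNReal.ofReal (((n : ℝ) + 1) * (M + δ)) := by
        gcongr with j hj
        exact hmean j ((Finset.mem_range.1 hj).trans_le hLK)
    _ = ENNReal.ofReal (((n : ℝ) + 1) * (L * (M + δ) / ((K : ℝ) + 1))) := by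
        rw [Finset.sum_const, Finset.card_range, nsmul_eq_mul, ← ENNReal.ofReal_natCast,
          ← ENNReal.ofReal_mul (by positivity), ← ENNReal.ofReal_inv_of_pos hKpos,
          ← ENNReal.ofReal_mul (by positivity)]
        congr 1
        field_simp

omit [IsProbabilityMeasure P] in
/-- **Overshoot blocks, by Markov.**  `Σ_i P(K+1 ≤ Σ_{j≤K} (X_{ij} − M)₊) ≤ (n+1)δ`. -/
theorem sum_meas_overshoot_le (hXm : ∀ i j, AEMeasurable (X i j) P) (K : ℕ) (M δ : ℝ)
    (hUI : ∀ j, j < K + 1 →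
      ∫⁻ ω, ENNReal.ofReal (((n : ℝ) + 1)⁻¹ * ∑ i : Fin (n + 1), max (X i j ω - M) 0) ∂P ≤ ENNReal.ofReal δ) :
    ∑ i : Fin (n + 1), P {ω | ((K : ℝ) + 1) ≤ ∑ j ∈ Finset.range (K + 1), max (X i j ω - M) 0} ≤
      ENNReal.ofReal (((n : ℝ) + 1) * δ) := by
  have hKpos : (0 : ℝ) < (K : ℝ) + 1 := by positivity
  have hmarkov : ∀ i, P {ω | ((K : ℝ) + 1) ≤ ∑ j ∈ Finset.range (K + 1), max (X i j ω - M) 0} ≤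
      (ENNReal.ofReal ((K : ℝ) + 1))⁻¹ *
        ∫⁻ ω, ENNReal.ofReal (∑ j ∈ Finset.range (K + 1), max (X i j ω - M) 0) ∂P :=
    fun i => meas_ge_le_inv_mul_lintegral
      (Finset.aemeasurable_fun_sum _ fun j _ => ((hXm i j).sub_const M).max aemeasurable_const) hKpos
  have hcastK : ((K + 1 : ℕ) : ℝ≥0∞) = ENNReal.ofReal ((K : ℝ) + 1) := by
    rw [← ENNReal.ofReal_natCast]
    push_cast
    rfl
  calc ∑ i : Fin (n + 1), P {ω | ((K : ℝ) + 1) ≤ ∑ j ∈ Finset.range (K + 1), max (X i j ω - M) 0}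
      ≤ ∑ i : Fin (n + 1), (ENNReal.ofReal ((K : ℝ) + 1))⁻¹ *
          ∫⁻ ω, ENNReal.ofReal (∑ j ∈ Finset.range (K + 1), max (X i j ω - M) 0) ∂P :=
        Finset.sum_le_sum fun i _ => hmarkov i
    _ = (ENNReal.ofReal ((K : ℝ) + 1))⁻¹ *
          ∑ i : Fin (n + 1), ∑ j ∈ Finset.range (K + 1), ∫⁻ ω, ENNReal.ofReal (max (X i j ω - M) 0) ∂P := by
        rw [← Finset.mul_sum]
        congr 1
        refine Finset.sum_congr rfl fun i _ => ?_
        exact lintegral_ofReal_sum (Finset.range (K + 1)) (fun j ω => max (X i j ω - M) 0)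
          (fun j _ => ((hXm i j).sub_const M).max aemeasurable_const) (fun j _ ω => le_max_right _ _)
    _ = (ENNReal.ofReal ((K : ℝ) + 1))⁻¹ *
          ∑ j ∈ Finset.range (K + 1), ∑ i : Fin (n + 1), ∫⁻ ω, ENNReal.ofReal (max (X i j ω - M) 0) ∂P := by
        rw [Finset.sum_comm]
    _ ≤ (ENNReal.ofReal ((K : ℝ) + 1))⁻¹ * ∑ _j ∈ Finset.range (K + 1), ENNReal.ofReal (((n : ℝ) + 1) * δ) := by
        gcongr with j hj
        exact sum_lintegral_le_of_average_le (fun i ω => max (X i j ω - M) 0)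
          (fun i => ((hXm i j).sub_const M).max aemeasurable_const) (fun i ω => le_max_right _ _) _
          (hUI j (Finset.mem_range.1 hj))
    _ = ENNReal.ofReal (((n : ℝ) + 1) * δ) := by
        rw [Finset.sum_const, Finset.card_range, nsmul_eq_mul, hcastK, ← mul_assoc,
          ENNReal.inv_mul_cancel (ENNReal.ofReal_pos.2 hKpos).ne' ENNReal.ofReal_ne_top, one_mul]

/-- **Assembly at fixed particle number.**  Nonnegative activities `a_i ≤ 2ā_i` a.e., the hinge bound
(`M'`, accuracy `B`), the per-sphere exceedance bound at the level `V_e` (from the engine) with the two Markov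
inputs (`M`, accuracy `δ`), and `2V_e ≤ V`: then
`∫⁻ ofReal ((n+1)⁻¹ Σ_i a_i𝟙{V < a_i}) ≤ ofReal (2B + 2M'(L(M+δ)/(K+1) + δ + M²/(4(K+1))))`. -/
theorem lintegral_tail_average_le (hXm : ∀ i j, AEMeasurable (X i j) P) (hX0 : ∀ i j ω, 0 ≤ X i j ω)
    (act : Fin (n + 1) → Ω → ℝ) (K L : ℕ) (hLK : L ≤ K + 1) {V Ve M M' δ B : ℝ} (hV : 2 * Ve ≤ V)
    (hM : 0 ≤ M) (hM' : 0 ≤ M') (hδ : 0 ≤ δ) (hB : 0 ≤ B)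
    (hdom : ∀ᵐ ω ∂P, ∀ i, act i ω ≤ 2 * (((K : ℝ) + 1)⁻¹ * ∑ j ∈ Finset.range (K + 1), X i j ω))
    (hUI' : ∀ j, j < K + 1 →
      ∫⁻ ω, ENNReal.ofReal (((n : ℝ) + 1)⁻¹ * ∑ i : Fin (n + 1), max (X i j ω - M') 0) ∂P ≤ ENNReal.ofReal B)
    (hUI : ∀ j, j < K + 1 →
      ∫⁻ ω, ENNReal.ofReal (((n : ℝ) + 1)⁻¹ * ∑ i : Fin (n + 1), max (X i j ω - M) 0) ∂P ≤ ENNReal.ofReal δ)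
    (hexc : ∀ i, P {ω | Ve < ((K : ℝ) + 1)⁻¹ * ∑ j ∈ Finset.range (K + 1), X i j ω} ≤
      P {ω | ((K : ℝ) + 1) ≤ ∑ j ∈ Finset.range L, X i j ω} +
        P {ω | ((K : ℝ) + 1) ≤ ∑ j ∈ Finset.range (K + 1), max (X i j ω - M) 0} +
        ENNReal.ofReal (M ^ 2 / (4 * ((K : ℝ) + 1)))) :
    ∫⁻ ω, ENNReal.ofReal (((n : ℝ) + 1)⁻¹ * ∑ i : Fin (n + 1), tailFn V (act i ω)) ∂P ≤
      ENNReal.ofReal (2 * B + 2 * M' * (L * (M + δ) / ((K : ℝ) + 1) + δ + M ^ 2 / (4 * ((K : ℝ) + 1)))) := by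
  have hKpos : (0 : ℝ) < (K : ℝ) + 1 := by positivity
  have hn0 : (0 : ℝ) < (n : ℝ) + 1 := by positivity
  -- block averages and dominating functions (opaque, with defining equations)
  obtain ⟨abar, habar⟩ : ∃ abar : Fin (n + 1) → Ω → ℝ,
      ∀ i ω, abar i ω = ((K : ℝ) + 1)⁻¹ * ∑ j ∈ Finset.range (K + 1), X i j ω := ⟨_, fun _ _ => rfl⟩
  have habm : ∀ i, AEMeasurable (abar i) P := fun i => by
    rw [show abar i = fun ω => ((K : ℝ) + 1)⁻¹ * ∑ j ∈ Finset.range (K + 1), X i j ω from funext (habar i)]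
    exact (Finset.aemeasurable_fun_sum (Finset.range (K + 1)) fun j _ => hXm i j).const_mul _
  obtain ⟨g, hg⟩ : ∃ g : Fin (n + 1) → Ω → ℝ, ∀ i ω, g i ω =
      2 * max (abar i ω - M') 0 + 2 * M' * Set.indicator {y : ℝ | Ve < y} (fun _ => (1 : ℝ)) (abar i ω) :=
    ⟨_, fun _ _ => rfl⟩
  have hg0 : ∀ i ω, 0 ≤ g i ω := fun i ω => by
    have : 0 ≤ Set.indicator {y : ℝ | Ve < y} (fun _ => (1 : ℝ)) (abar i ω) :=
      Set.indicator_nonneg (fun _ _ => zero_le_one) _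
    rw [hg]
    positivity
  have hind_m : ∀ i, AEMeasurable (fun ω => Set.indicator {y : ℝ | Ve < y} (fun _ => (1 : ℝ)) (abar i ω)) P :=
    fun i => ((measurable_const.indicator measurableSet_Ioi).comp_aemeasurable (habm i))
  have hgm : ∀ i, AEMeasurable (g i) P := fun i => by
    rw [show g i = fun ω => 2 * max (abar i ω - M') 0 +
        2 * M' * Set.indicator {y : ℝ | Ve < y} (fun _ => (1 : ℝ)) (abar i ω) from funext (hg i)]
    exact ((((habm i).sub_const M').max aemeasurable_const).const_mul 2).add ((hind_m i).const_mul _)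
  -- (1) pointwise a.e. domination of the integrand
  have hptw : ∀ᵐ ω ∂P, ((n : ℝ) + 1)⁻¹ * ∑ i : Fin (n + 1), tailFn V (act i ω) ≤
      ((n : ℝ) + 1)⁻¹ * ∑ i : Fin (n + 1), g i ω := by
    filter_upwards [hdom] with ω hω
    refine mul_le_mul_of_nonneg_left (Finset.sum_le_sum fun i _ => ?_) (by positivity)
    rw [hg]
    refine tailFn_le_hinge_add_indicator ?_ hM' hV
    rw [habar]
    exact hω i
  -- (2) per-sphere integral of the dominating function
  have hper : ∀ i, ∫⁻ ω, ENNReal.ofReal (g i ω) ∂P =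
      ENNReal.ofReal 2 * ∫⁻ ω, ENNReal.ofReal (max (abar i ω - M') 0) ∂P +
        ENNReal.ofReal (2 * M') * P {ω | Ve < abar i ω} := by
    intro i
    have h1 : ∀ ω, ENNReal.ofReal (g i ω) = ENNReal.ofReal (2 * max (abar i ω - M') 0) +
        ENNReal.ofReal (2 * M' * Set.indicator {y : ℝ | Ve < y} (fun _ => (1 : ℝ)) (abar i ω)) := by
      intro ω
      rw [hg, ENNReal.ofReal_add (by positivity)]
      exact mul_nonneg (by positivity) (Set.indicator_nonneg (fun _ _ => zero_le_one) _)
    simp_rw [h1]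
    have hm1 : AEMeasurable (fun ω => ENNReal.ofReal (2 * max (abar i ω - M') 0)) P :=
      ENNReal.measurable_ofReal.comp_aemeasurable ((((habm i).sub_const M').max aemeasurable_const).const_mul 2)
    have hm2 : AEMeasurable (fun ω => ENNReal.ofReal (max (abar i ω - M') 0)) P :=
      ENNReal.measurable_ofReal.comp_aemeasurable (((habm i).sub_const M').max aemeasurable_const)
    rw [lintegral_add_left' hm1]
    congr 1
    · simp_rw [ENNReal.ofReal_mul (show (0 : ℝ) ≤ 2 by norm_num)]
      rw [lintegral_const_mul'' _ hm2]
    · exact lintegral_ofReal_const_mul_indicator (habm i) (2 * M') Ve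
  -- (3) the hinge part and the exceedance part, summed over the spheres
  have hhinge : ∑ i : Fin (n + 1), ∫⁻ ω, ENNReal.ofReal (max (abar i ω - M') 0) ∂P ≤
      ENNReal.ofReal (((n : ℝ) + 1) * B) := by
    have h := sum_lintegral_hinge_average_le hXm K M' B hUI'
    refine le_trans (le_of_eq (Finset.sum_congr rfl fun i _ => ?_)) h
    simp_rw [habar]
  have hPsum : ∑ i : Fin (n + 1), P {ω | Ve < abar i ω} ≤
      ENNReal.ofReal (((n : ℝ) + 1) * (L * (M + δ) / ((K : ℝ) + 1))) + ENNReal.ofReal (((n : ℝ) + 1) * δ) +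
        ∑ _i : Fin (n + 1), ENNReal.ofReal (M ^ 2 / (4 * ((K : ℝ) + 1))) := by
    have hexc' : ∀ i, P {ω | Ve < abar i ω} ≤
        P {ω | ((K : ℝ) + 1) ≤ ∑ j ∈ Finset.range L, X i j ω} +
          P {ω | ((K : ℝ) + 1) ≤ ∑ j ∈ Finset.range (K + 1), max (X i j ω - M) 0} +
          ENNReal.ofReal (M ^ 2 / (4 * ((K : ℝ) + 1))) := by
      intro i
      have hset : {ω | Ve < abar i ω} = {ω | Ve < ((K : ℝ) + 1)⁻¹ * ∑ j ∈ Finset.range (K + 1), X i j ω} := by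
        ext ω
        simp only [Set.mem_setOf_eq, habar]
      rw [hset]
      exact hexc i
    calc ∑ i : Fin (n + 1), P {ω | Ve < abar i ω}
        ≤ ∑ i : Fin (n + 1), (P {ω | ((K : ℝ) + 1) ≤ ∑ j ∈ Finset.range L, X i j ω} +
            P {ω | ((K : ℝ) + 1) ≤ ∑ j ∈ Finset.range (K + 1), max (X i j ω - M) 0} +
            ENNReal.ofReal (M ^ 2 / (4 * ((K : ℝ) + 1)))) := Finset.sum_le_sum fun i _ => hexc' i
      _ = ∑ i : Fin (n + 1), P {ω | ((K : ℝ) + 1) ≤ ∑ j ∈ Finset.range L, X i j ω} +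
            ∑ i : Fin (n + 1), P {ω | ((K : ℝ) + 1) ≤ ∑ j ∈ Finset.range (K + 1), max (X i j ω - M) 0} +
            ∑ _i : Fin (n + 1), ENNReal.ofReal (M ^ 2 / (4 * ((K : ℝ) + 1))) := by
          rw [Finset.sum_add_distrib, Finset.sum_add_distrib]
      _ ≤ _ := add_le_add (add_le_add (sum_meas_firstBlocks_le hXm hX0 K L hLK hM hδ hUI)
            (sum_meas_overshoot_le hXm K M δ hUI)) le_rfl
  have hgsum : ∑ i : Fin (n + 1), ∫⁻ ω, ENNReal.ofReal (g i ω) ∂P =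
      ENNReal.ofReal 2 * ∑ i : Fin (n + 1), ∫⁻ ω, ENNReal.ofReal (max (abar i ω - M') 0) ∂P +
        ENNReal.ofReal (2 * M') * ∑ i : Fin (n + 1), P {ω | Ve < abar i ω} := by
    rw [Finset.mul_sum, Finset.mul_sum, ← Finset.sum_add_distrib]
    exact Finset.sum_congr rfl fun i _ => hper i
  -- (4) the real-arithmetic identity behind the last step
  have hcastN : ((n + 1 : ℕ) : ℝ≥0∞) = ENNReal.ofReal ((n : ℝ) + 1) := by
    rw [← ENNReal.ofReal_natCast]
    push_cast
    rfl
  have hfin : ENNReal.ofReal (((n : ℝ) + 1)⁻¹) *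
      (ENNReal.ofReal 2 * ENNReal.ofReal (((n : ℝ) + 1) * B) +
        ENNReal.ofReal (2 * M') * (ENNReal.ofReal (((n : ℝ) + 1) * (L * (M + δ) / ((K : ℝ) + 1))) +
          ENNReal.ofReal (((n : ℝ) + 1) * δ) +
          ∑ _i : Fin (n + 1), ENNReal.ofReal (M ^ 2 / (4 * ((K : ℝ) + 1))))) =
      ENNReal.ofReal (2 * B + 2 * M' * (L * (M + δ) / ((K : ℝ) + 1) + δ + M ^ 2 / (4 * ((K : ℝ) + 1)))) := by
    have hb : (0 : ℝ) ≤ ((n : ℝ) + 1) * (L * (M + δ) / ((K : ℝ) + 1)) := by positivity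
    have hc : (0 : ℝ) ≤ ((n : ℝ) + 1) * δ := by positivity
    have he : (0 : ℝ) ≤ ((n : ℝ) + 1) * (M ^ 2 / (4 * ((K : ℝ) + 1))) := by positivity
    rw [Finset.sum_const, Finset.card_univ, Fintype.card_fin, nsmul_eq_mul, hcastN,
      ← ENNReal.ofReal_mul hn0.le, ← ENNReal.ofReal_mul (show (0 : ℝ) ≤ 2 by norm_num),
      ← ENNReal.ofReal_add hb hc, ← ENNReal.ofReal_add (add_nonneg hb hc) he,
      ← ENNReal.ofReal_mul (show (0 : ℝ) ≤ 2 * M' by positivity),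
      ← ENNReal.ofReal_add (by positivity) (by positivity), ← ENNReal.ofReal_mul (inv_nonneg.2 hn0.le)]
    congr 1
    field_simp
  -- (5) the chain
  calc ∫⁻ ω, ENNReal.ofReal (((n : ℝ) + 1)⁻¹ * ∑ i : Fin (n + 1), tailFn V (act i ω)) ∂P
      ≤ ∫⁻ ω, ENNReal.ofReal (((n : ℝ) + 1)⁻¹ * ∑ i : Fin (n + 1), g i ω) ∂P :=
        lintegral_mono_ae (hptw.mono fun ω hω => ENNReal.ofReal_le_ofReal hω)
    _ = ENNReal.ofReal (((n : ℝ) + 1)⁻¹) * ∑ i : Fin (n + 1), ∫⁻ ω, ENNReal.ofReal (g i ω) ∂P :=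
        lintegral_ofReal_average_eq g hgm hg0
    _ = ENNReal.ofReal (((n : ℝ) + 1)⁻¹) *
          (ENNReal.ofReal 2 * ∑ i : Fin (n + 1), ∫⁻ ω, ENNReal.ofReal (max (abar i ω - M') 0) ∂P +
            ENNReal.ofReal (2 * M') * ∑ i : Fin (n + 1), P {ω | Ve < abar i ω}) := by rw [hgsum]
    _ ≤ ENNReal.ofReal (((n : ℝ) + 1)⁻¹) *
          (ENNReal.ofReal 2 * ENNReal.ofReal (((n : ℝ) + 1) * B) +
            ENNReal.ofReal (2 * M') * (ENNReal.ofReal (((n : ℝ) + 1) * (L * (M + δ) / ((K : ℝ) + 1))) +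
              ENNReal.ofReal (((n : ℝ) + 1) * δ) +
              ∑ _i : Fin (n + 1), ENNReal.ofReal (M ^ 2 / (4 * ((K : ℝ) + 1))))) :=
        mul_le_mul_of_nonneg_left (add_le_add (mul_le_mul_of_nonneg_left hhinge (zero_le))
          (mul_le_mul_of_nonneg_left hPsum (zero_le))) (zero_le)
    _ = ENNReal.ofReal (2 * B + 2 * M' * (L * (M + δ) / ((K : ℝ) + 1) + δ + M ^ 2 / (4 * ((K : ℝ) + 1)))) := hfin

end FixedN

/-- **Registered sub-goal `stub_driftTransferFixedN`** (line `Sketch`, lead a1; route-internal, not a cited fact):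
the fixed-`N` assembly of the transfer — for nonnegative a.e.-measurable block activities on a probability space,
activities `a_i ≤ 2ā_i` a.e., the two one-block UI inputs and the engine's per-sphere exceedance bound,
`∫⁻ ofReal ((n+1)⁻¹Σ_i a_i𝟙{V < a_i}) ≤ ofReal (2B + 2M'(L(M+δ)/(K+1) + δ + M²/(4(K+1))))`. -/
def DriftTransferFixedN : Prop :=
  ∀ (Ω : Type) [MeasurableSpace Ω] (P : Measure Ω) [IsProbabilityMeasure P] (n : ℕ)
    (X : Fin (n + 1) → ℕ → Ω → ℝ), (∀ i j, AEMeasurable (X i j) P) → (∀ i j ω, 0 ≤ X i j ω) →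
    ∀ (act : Fin (n + 1) → Ω → ℝ) (K L : ℕ), L ≤ K + 1 → ∀ (V Ve M M' δ B : ℝ), 2 * Ve ≤ V →
    0 ≤ M → 0 ≤ M' → 0 ≤ δ → 0 ≤ B →
    (∀ᵐ ω ∂P, ∀ i, act i ω ≤ 2 * (((K : ℝ) + 1)⁻¹ * ∑ j ∈ Finset.range (K + 1), X i j ω)) →
    (∀ j, j < K + 1 →
      ∫⁻ ω, ENNReal.ofReal (((n : ℝ) + 1)⁻¹ * ∑ i : Fin (n + 1), max (X i j ω - M') 0) ∂P ≤ ENNReal.ofReal B) →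
    (∀ j, j < K + 1 →
      ∫⁻ ω, ENNReal.ofReal (((n : ℝ) + 1)⁻¹ * ∑ i : Fin (n + 1), max (X i j ω - M) 0) ∂P ≤ ENNReal.ofReal δ) →
    (∀ i, P {ω | Ve < ((K : ℝ) + 1)⁻¹ * ∑ j ∈ Finset.range (K + 1), X i j ω} ≤
      P {ω | ((K : ℝ) + 1) ≤ ∑ j ∈ Finset.range L, X i j ω} +
        P {ω | ((K : ℝ) + 1) ≤ ∑ j ∈ Finset.range (K + 1), max (X i j ω - M) 0} +
        ENNReal.ofReal (M ^ 2 / (4 * ((K : ℝ) + 1)))) →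
    ∫⁻ ω, ENNReal.ofReal (((n : ℝ) + 1)⁻¹ * ∑ i : Fin (n + 1), tailFn V (act i ω)) ∂P ≤
      ENNReal.ofReal (2 * B + 2 * M' * (L * (M + δ) / ((K : ℝ) + 1) + δ + M ^ 2 / (4 * ((K : ℝ) + 1))))

/-- The registered sub-goal `stub_driftTransferFixedN` holds (`lintegral_tail_average_le`). -/
theorem stub_driftTransferFixedN : DriftTransferFixedN :=
  fun _Ω _ _P _ _n _X hXm hX0 act K L hLK _V _Ve _M _M' _δ _B hV hM hM' hδ hB hdom hUI' hUI hexc =>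
    lintegral_tail_average_le hXm hX0 act K L hLK hV hM hM' hδ hB hdom hUI' hUI hexc

end Summit.AtomisticToContinuum.HydrodynamicLimit.Theorems.TransferActivityTailsDriftTransferFixedN

end
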